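import Literature.RingTheory.MvPowerSeries.MonoidPowerSeries
import Literature.RingTheory.MvPowerSeries.MaximalIdealPow
import HarnessLib

/-!
# Realisability bridge: a local ring with PERFECT residue field of characteristic `p`, mapped into `K⟦X_τ⟧`, lands in the
# completed monoid algebra `K⟦P⟧` as soon as a generating set of its maximal ideal does

W4.1 support file (crux `Steer`, stmt-ResolutionOfSingularities-16345; line `switching_dichotomy`), res-D-pv-007 AS
res-L0-w41-stub-5 — stage (R) of the Lemma S kernel `…NoSatelliteStep` (plan-1 RULINGS 136a/147c; res-L0-w41-idea-3 NT-DIRECT §1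
(3)(α) «REALISABILITY: `x^d f₁ = f₀ − g₀² ∈ φ(Ŝ₀) = K⟦x, xy, xz⟧`») and, at general weight, of res-L0-w41-stub-2's Lemma F♭
PART 3 («`f₀` read in the stage-`M` coordinates lies in `K⟦x, x^M ỹ, x^M z̃⟧`»). It replaces the completed chart map
`Ŝ₀ → Ŝ₁` and every coefficient-field compatibility (no Teichmüller lifts, no second Cohen frame) by a FINITE-LEVEL argument
inside ONE power series ring:

**`map_mem_monoidPowerSeries`.** Let `S₀` be a local ring whose residue field has surjective `p`-Frobenius (perfect), `K` a field
of characteristic `p`, `ι : S₀ →+* K⟦X_τ⟧` a ring homomorphism (`τ` arbitrary), `P ⊆ ℕ^{(τ)}` a submonoid of exponents, and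
`G` a finite generating set of `𝔪_{S₀}` such that every `ι g`, `g ∈ G`, lies in `K⟦P⟧` and has zero constant term. Then
`ι(S₀) ⊆ K⟦P⟧ = monoidPowerSeries K P`.

Proof (`exists_mem_sub_mem_pow`, induction on the order `N`): given `s`, pick `u ∈ S₀` with `ū^{pⁿ} = s̄` (`pⁿ ≥ N + 1`; perfect
residue field), so `s − u^{pⁿ} = Σ_{g ∈ G} c_g g`; `ι u = C c + m` with `m ∈ 𝔪` gives `ι(u)^{pⁿ} = C c^{pⁿ} + m^{pⁿ}`
(characteristic `p`), `m^{pⁿ} ∈ 𝔪^{pⁿ}`; recurse on the `c_g` (order `N`) and multiply by `ι g ∈ K⟦P⟧ ∩ 𝔪`. Since membership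
in `K⟦P⟧` is coefficientwise and `𝔪^N` has no coefficients below degree `N` (`Jets.coeff_eq_zero_of_mem_maximalIdeal_pow`),
`ι s ∈ K⟦P⟧` (`mem_of_forall_exists_sub_mem_pow`).

Also: `exists_pow_prime_pow_eq` (iterated `p`-th roots in a perfect residue field), `exists_sub_pow_mem_maximalIdeal`
(`s ≡ u^{pⁿ} mod 𝔪₀`), `C_add_pow_prime_pow` (`(C c + m)^{pⁿ} = C c^{pⁿ} + m^{pⁿ}`).

Elementary [folklore; cite: Kato1994, §3 for `K⟦P⟧`; cite: Matsumura1987, §28 for coefficient rings of complete local rings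
(the statement here is a finite-level substitute)]. OURS (campaign res-hironaka); nothing here is attributed to [Hironaka2017]. -/

noncomputable section

-- `Summit.<S>.<S>.…` duplicates the summit name by design (single-problem summit).
set_option linter.dupNamespace false

open MvPowerSeries IsLocalRing
open Literature.RingTheory.MvPowerSeries

namespace Summit.ResolutionOfSingularities.ResolutionOfSingularities.Theorems.SwitchingDichotomy.ChartRealisability

universe u v w

variable {S₀ : Type u} [CommRing S₀] [IsLocalRing S₀] {τ : Type v} {K : Type w} [Field K] (p : ℕ) [hp : Fact p.Prime]

omit hp in
/-- Iterated `p`-th roots: if the `p`-Frobenius of the residue field is surjective, so is the `pⁿ`-Frobenius. [folklore] -/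
theorem exists_pow_prime_pow_eq (hperf : ∀ a : ResidueField S₀, ∃ b : ResidueField S₀, b ^ p = a) (n : ℕ)
    (a : ResidueField S₀) : ∃ b : ResidueField S₀, b ^ p ^ n = a := by
  induction n generalizing a with
  | zero => exact ⟨a, by rw [pow_zero, pow_one]⟩
  | succ n ih =>
    obtain ⟨b, rfl⟩ := hperf a
    obtain ⟨c, rfl⟩ := ih b
    exact ⟨c, by rw [pow_succ, pow_mul]⟩

omit hp in
/-- **`s ≡ u^{pⁿ} (mod 𝔪₀)`** for some `u ∈ S₀`, when the residue field of the local ring `S₀` is perfect. [folklore] -/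
theorem exists_sub_pow_mem_maximalIdeal (hperf : ∀ a : ResidueField S₀, ∃ b : ResidueField S₀, b ^ p = a) (n : ℕ)
    (s : S₀) : ∃ u : S₀, s - u ^ p ^ n ∈ maximalIdeal S₀ := by
  obtain ⟨b, hb⟩ := exists_pow_prime_pow_eq p hperf n (residue S₀ s)
  obtain ⟨u, rfl⟩ := residue_surjective b
  refine ⟨u, ?_⟩
  rw [← residue_eq_zero_iff, map_sub, map_pow, hb, sub_self]

omit hp in
/-- **`(C c + m)^{pⁿ} = C c^{pⁿ} + m^{pⁿ}`** in `K⟦X⟧`, `K` of characteristic `p`. [folklore] -/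
theorem C_add_pow_prime_pow [CharP K p] (hp' : p.Prime) (c : K) (m : MvPowerSeries τ K) (n : ℕ) :
    (C c + m) ^ p ^ n = C (c ^ p ^ n) + m ^ p ^ n := by
  haveI := Fact.mk hp'
  haveI : CharP (MvPowerSeries τ K) p := charP_of_injective_algebraMap (C_injective (σ := τ) (R := K)) p
  rw [add_pow_char_pow, map_pow]

variable [CharP K p] (ι : S₀ →+* MvPowerSeries τ K) (P : AddSubmonoid (τ →₀ ℕ)) (G : Finset S₀)

/-- The induction: **every `ι s` is congruent modulo `𝔪^N` to an element of `K⟦P⟧`**, for every `N`. [folklore] -/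
theorem exists_mem_sub_mem_pow (hperf : ∀ a : ResidueField S₀, ∃ b : ResidueField S₀, b ^ p = a)
    (hG : Ideal.span (G : Set S₀) = maximalIdeal S₀)
    (hιP : ∀ g ∈ G, ι g ∈ monoidPowerSeries K P) (hι0 : ∀ g ∈ G, constantCoeff (ι g) = 0) (N : ℕ) (s : S₀) :
    ∃ a ∈ monoidPowerSeries K P, ι s - a ∈ maximalIdeal (MvPowerSeries τ K) ^ N := by
  classical
  induction N generalizing s with
  | zero => exact ⟨0, Subalgebra.zero_mem _, by rw [pow_zero, Ideal.one_eq_top]; exact Submodule.mem_top⟩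
  | succ N ih =>
    -- `s = u^{pⁿ} + Σ_g c_g g` with `pⁿ ≥ N + 1`
    set n := N + 1 with hn
    have hpn : N + 1 ≤ p ^ n := (Nat.lt_pow_self hp.out.one_lt).le
    obtain ⟨u, hu⟩ := exists_sub_pow_mem_maximalIdeal p hperf n s
    rw [← hG, ← Ideal.submodule_span_eq, Submodule.mem_span_finset] at hu
    obtain ⟨c, -, hc⟩ := hu
    -- recurse on the coefficients `c g`
    choose a ha hsub using fun g : S₀ => ih (c g)
    -- split `ι u = C c₀ + m`
    set c₀ : K := constantCoeff (ι u) with hc₀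
    set m : MvPowerSeries τ K := ι u - C c₀ with hm
    have hm0 : constantCoeff m = 0 := by rw [hm, map_sub, constantCoeff_C, hc₀, sub_self]
    have hmmem : m ∈ maximalIdeal (MvPowerSeries τ K) := Jets.mem_maximalIdeal_iff_constantCoeff_eq_zero.mpr hm0
    have hιu : ι u = C c₀ + m := by rw [hm]; ring
    refine ⟨C (c₀ ^ p ^ n) + ∑ g ∈ G, ι g * a g, ?_, ?_⟩
    · refine Subalgebra.add_mem _ (monoidPowerSeries.C_mem _) (Subalgebra.sum_mem _ fun g hg => ?_)
      exact Subalgebra.mul_mem _ (hιP g hg) (ha g)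
    · -- `ι s − a = m^{pⁿ} + Σ_g ι g · (ι (c g) − a g)`
      have hs : s = u ^ p ^ n + ∑ g ∈ G, g * c g := by
        rw [← sub_eq_iff_eq_add', ← hc]
        exact Finset.sum_congr rfl fun g _ => by rw [smul_eq_mul, mul_comm]
      have hkey : ι s - (C (c₀ ^ p ^ n) + ∑ g ∈ G, ι g * a g) =
          m ^ p ^ n + ∑ g ∈ G, ι g * (ι (c g) - a g) := by
        rw [hs, map_add, map_pow, hιu, C_add_pow_prime_pow p hp.out, map_sum]
        simp only [map_mul, mul_sub, Finset.sum_sub_distrib]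
        ring
      rw [hkey]
      refine Ideal.add_mem _ ?_ (Ideal.sum_mem _ fun g hg => ?_)
      · exact Ideal.pow_le_pow_right hpn (Ideal.pow_mem_pow hmmem _)
      · rw [pow_succ']
        exact Ideal.mul_mem_mul (Jets.mem_maximalIdeal_iff_constantCoeff_eq_zero.mpr (hι0 g hg)) (hsub g)

/-- Coefficientwise closedness of `K⟦P⟧`: a series congruent to elements of `K⟦P⟧` modulo every `𝔪^N` lies in `K⟦P⟧`.
[cite: Kato1994, §3] -/
theorem mem_of_forall_exists_sub_mem_pow {F : MvPowerSeries τ K}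
    (h : ∀ N : ℕ, ∃ a ∈ monoidPowerSeries K P, F - a ∈ maximalIdeal (MvPowerSeries τ K) ^ N) :
    F ∈ monoidPowerSeries K P := by
  intro e he
  obtain ⟨a, ha, hFa⟩ := h (e.degree + 1)
  have h1 : coeff e (F - a) = 0 := Jets.coeff_eq_zero_of_mem_maximalIdeal_pow hFa (Nat.lt_succ_self _)
  rw [map_sub, monoidPowerSeries.coeff_eq_zero_of_mem ha he, sub_zero] at h1
  exact h1

/-- **REALISABILITY BRIDGE.** A local ring `S₀` with perfect residue field of characteristic `p`, mapped by a ring homomorphism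
`ι` into `K⟦X_τ⟧` (`K` a field of characteristic `p`), lands in the completed monoid algebra `K⟦P⟧` as soon as the images of a
finite generating set of `𝔪_{S₀}` lie in `K⟦P⟧` with zero constant term. (NT-DIRECT (α) with `P` = the blow-up monoid
`{b + |γ| ≤ a}`: `S₀ ↪ S₁ → Ŝ₁ ≃ K⟦x, y, z⟧` sends `X ↦ x`, `Y ↦ xy + c·x`, `Z ↦ xz + c′·x`, hence ALL of `S₀` into `K⟦x, xy, xz⟧`;
Lemma F♭ with `P = {M(b + c) ≤ a}`.) [folklore] -/
theorem map_mem_monoidPowerSeries (hperf : ∀ a : ResidueField S₀, ∃ b : ResidueField S₀, b ^ p = a)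
    (hG : Ideal.span (G : Set S₀) = maximalIdeal S₀)
    (hιP : ∀ g ∈ G, ι g ∈ monoidPowerSeries K P) (hι0 : ∀ g ∈ G, constantCoeff (ι g) = 0) (s : S₀) :
    ι s ∈ monoidPowerSeries K P :=
  mem_of_forall_exists_sub_mem_pow P fun N => exists_mem_sub_mem_pow p ι P G hperf hG hιP hι0 N s

/-- The same as an inclusion of subrings: `ι(S₀) ⊆ K⟦P⟧`. [folklore] -/
theorem range_le_monoidPowerSeries (hperf : ∀ a : ResidueField S₀, ∃ b : ResidueField S₀, b ^ p = a)
    (hG : Ideal.span (G : Set S₀) = maximalIdeal S₀)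
    (hιP : ∀ g ∈ G, ι g ∈ monoidPowerSeries K P) (hι0 : ∀ g ∈ G, constantCoeff (ι g) = 0) :
    ι.range ≤ (monoidPowerSeries K P).toSubring := by
  rintro _ ⟨s, rfl⟩
  exact map_mem_monoidPowerSeries p ι P G hperf hG hιP hι0 s

end Summit.ResolutionOfSingularities.ResolutionOfSingularities.Theorems.SwitchingDichotomy.ChartRealisability

end
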